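import Summits.CriticalPhenomena.PercolationContinuityZ3.Theorems.PercNearOneGluingNoHeavyQuantFlowGiantMin
import Summits.CriticalPhenomena.PercolationContinuityZ3.Theorems.PercNearOneGluingNoHeavyQuantIncomeDichotomy
import Summits.CriticalPhenomena.PercolationContinuityZ3.Theorems.PercNearOneGluingNoHeavyQuantLawDecFlowsDecomposition
import HarnessLib

/-!
# QUANT lane R8, T-DEC: THE ZERO-LAST PRINCIPLE — a law is DEC at its mean as soon as its NONZERO lows admit a routing within capacity that
# either uses no giant or leaves giant room for the zero plus its own giant-routed mass (`decAtT_of_zeroFreeRouting`)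

builds on p205010 (kernel theorem, internal audit signed; external expert review pending)

Support file (`--supports stmt-CriticalPhenomena-4575`), QUANT lane seat prim-quant-arm-1 (gen 39), rung R8 of
`run/shared/lean/prim/quant/LADDER.md`.  Theorems only (no definitions), standard axioms, no sorries.  Assembles this seat's
`…QuantFlowGiantMin` (a giant-minimal witness exists and saturates the mids, NF (n4)) and `…QuantIncomeDichotomy` (cases (A)/(B) of the income
criterion).  Memo `run/shared/lean/prim/quant/prim-quant-arm-1-g39/TWIN-MOVE-G39.md` §8–§9.

THE PRINCIPLE.  `A ≥ 0` a probability law on `{0..M}` with mean `T > 0` (first moment `≥ T`), floor `0 < x < 1`, `x·M ≤ T`, layer `j`.  Write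
`A⁰` for `A` with the zero atom removed.  A ROUTING OF THE NONZERO LOWS is a flow witness of `A⁰` at `(x, T, j, M)` (`LawDec.IsFlowAtT`: the
nonzero lows shipped exactly into compatible mids / giants within the capacities `A h`; the zero row is empty).  If such a routing `χ` exists
and EITHER it puts nothing on the giants OR `x/(1−x)·(A 0 + W_χ) ≤ Σ_{j<h≤M} A h` (`W_χ` = its giant-routed mass), then `DECAtT x T j M A`.
Proof: replace `χ` by a giant-MINIMAL routing `ψ` (`exists_isFlowAtT_giantMin`, `W_ψ ≤ W_χ`); if `W_ψ = 0` every nonzero low sits in a mid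
and case (A) `flowAtT_of_midRouting` applies; else some low is giant-routed, every mid above `T` is compatible with it hence FULL
(`IsFlowAtT.mid_saturated_of_giantMin`), and case (B) `flowAtT_of_fullMids` applies with `W_ψ ≤ W_χ`.  Criterion E (all lows on the giants) and
the first-moment criterion (no nonzero low) are the two ends; the recipe for `LawDec.TwinMoveDEC` (transfer + pour, `…QuantFlowTransfer`,
`…QuantFlowPour`) produces exactly such a `χ`.

* **`LawDec.decAtT_of_zeroFreeRouting`** — the principle.

[this work]; nothing here is cited as a published result.  The gluing rows served [cite: KozmaNitzan2024, Conjecture 3 (p. 15)]; product measure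
[cite: Grimmett1999, §1.3 p. 10].
-/

noncomputable section

namespace Summit.CriticalPhenomena.PercolationContinuityZ3.Theorems

namespace Quant

open Finset

namespace LawDec

/-- **THE ZERO-LAST PRINCIPLE.**  See the module docstring. [this work] -/
theorem decAtT_of_zeroFreeRouting (x T : ℝ) (j M : ℕ) (A : ℕ → ℝ) (χ : ℕ → ℕ → ℝ) (hx0 : 0 < x) (hx1 : x < 1) (hT : 0 < T)
    (hA0 : ∀ h, 0 ≤ A h) (hAM : ∀ h, M < h → A h = 0) (hA1 : ∑ h ∈ Finset.range (M + 1), A h = 1)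
    (hta : x * (M : ℝ) ≤ T)
    (hmom : T * ∑ h ∈ Finset.range (M + 1), A h ≤ ∑ h ∈ Finset.range (M + 1), (h : ℝ) * A h)
    (hχ : IsFlowAtT x T j M (fun h => if h = 0 then 0 else A h) χ)
    (hE : ∑ l ∈ Finset.range (j + 1), ∑ g ∈ Finset.Ico (j + 1) (M + 1), χ l g = 0 ∨
      x / (1 - x) * (A 0 + ∑ l ∈ Finset.range (j + 1), ∑ g ∈ Finset.Ico (j + 1) (M + 1), χ l g)
        ≤ ∑ h ∈ Finset.Ico (j + 1) (M + 1), A h) :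
    DECAtT x T j M A := by
  classical
  set A0 : ℕ → ℝ := fun h => if h = 0 then 0 else A h with hA0def
  have htaH : ∀ h : ℕ, h ≤ j → h ≤ M → T < (h : ℝ) → x * (h : ℝ) ≤ T := fun h _ hhM _ =>
    (mul_le_mul_of_nonneg_left (by exact_mod_cast hhM) hx0.le).trans hta
  have hA0le : ∀ h, A0 h ≤ A h := fun h => by simp only [hA0def]; split_ifs <;> linarith [hA0 h]
  -- a giant-minimal routing of the nonzero lows
  obtain ⟨ψ, hψ, hmin⟩ := exists_isFlowAtT_giantMin x T j M A0 ⟨χ, hχ⟩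
  have hWle : ∑ l ∈ Finset.range (j + 1), ∑ g ∈ Finset.Ico (j + 1) (M + 1), ψ l g
      ≤ ∑ l ∈ Finset.range (j + 1), ∑ g ∈ Finset.Ico (j + 1) (M + 1), χ l g := hmin χ hχ
  obtain ⟨hψ0, hψsupp, hψrow, hψcol⟩ := id hψ
  -- the zero row is empty, so every charged low is `≥ 1`
  have hψzero : ∀ h, ψ 0 h = 0 := by
    intro h
    have hr := hψrow 0 (Nat.zero_le _) (by simpa using hT)
    simp only [hA0def, if_pos rfl] at hr
    by_contra hne
    have hpos : 0 < ψ 0 h := lt_of_le_of_ne (hψ0 0 h) (Ne.symm hne)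
    obtain ⟨_, _, hhM, _⟩ := hψsupp 0 h hpos
    have : ψ 0 h ≤ ∑ h' ∈ Finset.range (M + 1), ψ 0 h' :=
      Finset.single_le_sum (fun h' _ => hψ0 0 h') (Finset.mem_range.2 (by omega))
    linarith
  have hsupp1 : ∀ l h, 0 < ψ l h → (1 ≤ l ∧ l ≤ j ∧ 2 * (l : ℝ) < T) ∧ h ≤ M ∧ (j + 1 ≤ h ∨ T < (l : ℝ) + h) := by
    intro l h hp
    obtain ⟨hlj, hlow, hhM, hc⟩ := hψsupp l h hp
    have h1 : 1 ≤ l := by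
      by_contra h0
      have : l = 0 := by omega
      rw [this, hψzero] at hp; exact lt_irrefl _ hp
    exact ⟨⟨h1, hlj, hlow⟩, hhM, hc⟩
  have hrow1 : ∀ l : ℕ, 1 ≤ l → l ≤ j → 2 * (l : ℝ) < T → ∑ h ∈ Finset.range (M + 1), ψ l h = A l := by
    intro l h1 hlj hlow
    rw [hψrow l hlj hlow]; simp only [hA0def, if_neg (show l ≠ 0 by omega)]
  have hcol1 : ∀ h, h ≤ M → (j + 1 ≤ h ∨ T ≤ 2 * (h : ℝ)) → ∑ l ∈ Finset.range (j + 1), usage x T j l h * ψ l h ≤ A h :=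
    fun h hhM habs => (hψcol h hhM habs).trans (hA0le h)
  set W : ℝ := ∑ l ∈ Finset.range (j + 1), ∑ g ∈ Finset.Ico (j + 1) (M + 1), ψ l g with hW
  have hW0 : 0 ≤ W := Finset.sum_nonneg fun l _ => Finset.sum_nonneg fun g _ => hψ0 l g
  refine decAtT_of_flowAtT x T j M A hx0 hx1 hAM hA1 ?_
  rcases hW0.eq_or_lt with hWz | hWpos
  · -- case (A): nothing on the giants ⟹ every charged pair is a mid pair
    have hnog : ∀ l g, j + 1 ≤ g → ψ l g = 0 := by
      intro l g hg
      by_contra hne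
      have hpos : 0 < ψ l g := lt_of_le_of_ne (hψ0 l g) (Ne.symm hne)
      obtain ⟨⟨_, hlj, _⟩, hgM, _⟩ := hsupp1 l g hpos
      have h1 : ψ l g ≤ ∑ g' ∈ Finset.Ico (j + 1) (M + 1), ψ l g' :=
        Finset.single_le_sum (fun g' _ => hψ0 l g') (Finset.mem_Ico.2 ⟨hg, by omega⟩)
      have h2 : ∑ g' ∈ Finset.Ico (j + 1) (M + 1), ψ l g' ≤ W :=
        Finset.single_le_sum (fun l' _ => Finset.sum_nonneg fun g' _ => hψ0 l' g') (Finset.mem_range.2 (by omega))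
      linarith
    refine flowAtT_of_midRouting x T j M A ψ hx0 hx1 hT hA0 hAM hta hψ0 (fun l h hp => ?_) hrow1 (fun h hhj hhM hmid => hcol1 h hhM (Or.inr hmid)) hmom
    obtain ⟨hl, hhM, hc⟩ := hsupp1 l h hp
    have hng : ¬ (j + 1 ≤ h) := fun hg => by rw [hnog l h hg] at hp; exact lt_irrefl _ hp
    have hc' : T < (l : ℝ) + h := hc.resolve_left hng
    exact ⟨hl, by omega, hhM, by linarith [hl.2.2], hc'⟩
  · -- case (B): some low is giant-routed ⟹ all mids above `T` are full
    obtain ⟨l₀, hl₀, hrowpos⟩ := Finset.exists_lt_of_sum_lt (by simpa [hW] using hWpos :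
      ∑ l ∈ Finset.range (j + 1), (0:ℝ) < ∑ l ∈ Finset.range (j + 1), ∑ g ∈ Finset.Ico (j + 1) (M + 1), ψ l g)
    obtain ⟨g₀, hg₀, hpos⟩ := Finset.exists_lt_of_sum_lt (by simpa using hrowpos :
      ∑ g ∈ Finset.Ico (j + 1) (M + 1), (0:ℝ) < ∑ g ∈ Finset.Ico (j + 1) (M + 1), ψ l₀ g)
    have hg₀' : j + 1 ≤ g₀ := (Finset.mem_Ico.1 hg₀).1
    have hfull : ∀ h : ℕ, h ≤ j → h ≤ M → T < (h : ℝ) → ∑ l ∈ Finset.range (j + 1), usage x T j l h * ψ l h = A h := by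
      intro h hhj hhM hTh
      have hcomp : T < (l₀ : ℝ) + h := by have : (0:ℝ) ≤ l₀ := Nat.cast_nonneg l₀; linarith
      have hmid : T ≤ 2 * (h : ℝ) := by have : (0:ℝ) ≤ h := Nat.cast_nonneg h; linarith
      have := hψ.mid_saturated_of_giantMin hx0 hx1 hmin l₀ g₀ h hg₀' hpos hhj hhM hmid hcomp
      rw [this]; simp only [hA0def]
      rw [if_neg (by rintro rfl; simp at hTh; linarith)]
    have hE' : x / (1 - x) * (A 0 + W) ≤ ∑ h ∈ Finset.Ico (j + 1) (M + 1), A h := by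
      rcases hE with hz | hineq
      · -- `W ≤ W_χ = 0` contradicts `W > 0`
        exfalso; linarith
      · have hx' : 0 ≤ x / (1 - x) := div_nonneg hx0.le (by linarith)
        exact (mul_le_mul_of_nonneg_left (by linarith) hx').trans hineq
    exact flowAtT_of_fullMids x T j M A ψ hx0 hx1 hT hA0 htaH hψ0 hsupp1 hrow1 hcol1 hfull hE'

end LawDec

end Quant

end Summit.CriticalPhenomena.PercolationContinuityZ3.Theorems
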